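import Summits.QuantumFields.YangMills.Theorems.BalabanUVNodesN12MinimiserFamilyKnitRowOfK0GridGOnZOfRecord
import Literature.MathematicalPhysics.QuantumFieldTheory.Balaban1983to89.B11Thm1ExistsUniqueCoP7MG
import HarnessLib

/-!
# BalabanUVNodes ∕ N12 — THE KNIT's (J0′) ROW OF RECORD FROM TWO NAMED [15]-THEOREM-1 FACTS IN THE K0 ROAD's REGISTERED (GRID-GUARDED) CURRENCY: the (8)-sentence
# `Node00.VariationalThm1RegSepCoP7MG F 2 A‴ B₃ a₀ a₁` and the lane's existence ∕ uniqueness fact `B11Thm1ExistsUniqueCoP7MG.VariationalThm1EUSepCoP7MG F 2 A‴ B₃ a₀ a₁` — ZERO anonymous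
# [15] letters (§1); the same from K0⁷'s registered stub-1 text `K0V22ZDefs.Prop8StepCoPGridGAt F` (§2); and the floor-free (E∕U) name `VariationalThm1EUSepCoP7M` (§3)
# ([Balaban1985Variational] (1) p.277, (2)–(7) p.278, Thm 1 (8) p.279, Prop. 8 p.304, Sect. G pp.305–307, Prop. 9 (190) p.309; [Balaban1989LargeFieldI] (1.74) p.192, Prop. 1 p.194;
# [Balaban1985RegularSpaces] (1.3)–(1.9) p.77; [Balaban1989LargeFieldII] (1.12)–(1.13) p.359; [Balaban1988Convergent] (2.1) p.254, (2.5) p.255, (2.12)–(2.13) p.256, (2.17)–(2.18) p.257;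
# [Balaban1985Averaging] (8)–(9) pp.18–19, Prop. 2 (52)–(54) p.26, (122)–(126) p.36; [Balaban1987RG1] (0.1) p.251, (0.4) p.253)

Cell `pub-ymgap` (HUMAN RULINGS D-0062 ∕ D-0149), seat `pub-ymgap-dag-n12-d` g26 (R134 N12 [B15] s2 = by-name knit at the record; census item E1 = the (J0′) row; count-neutral helper of K1⁹
`stmt-QuantumFields-27364`, `--kind proof --supports … --as helper`).  THEOREMS ONLY (0 `def`, 0 `instance`, 0 `sorry`); THREE compositions BY NAME.  Ninth leaf of the junction family.

WHAT.  `…KnitRowOfK0GridGOnZOfRecord` (✓p741587) §1 keys the (J0′) head's (8)-letter on the K0 road's REGISTERED currency `Node00.VariationalThm1RegSepCoP7MG F 2 A‴(c′,c₀,c₁) B₃ a₀ a₁`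
(K0⁷ stmt-QuantumFields-20541, skeleton V22-Z: stub 3ᴬ′-G‴-Z's antecedent ∕ dag-n07-e's `variationalThm1RegSepCoP7MG_of_prop8TopStepG` on the registered stub-1 text) and its (E∕U)-letter on
ONE guard-generic sentence in NODE 00's house shape (text).  The lane dag-n12-c has since NAMED that sentence — g29 ✓p740853 `B11Thm1ExistsUniqueCoP7M.VariationalThm1EUSepCoP7M` (floor-free)
and g30 `B11Thm1ExistsUniqueCoP7MG.VariationalThm1EUSepCoP7MG (Adm : StepGuard F)` (GUARDED, `Adm` placed VERBATIM as in K0⁷'s `…RegSepCoP7MG`: `0 < k` right after `s`, `Adm ν M g K k s` right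
after `0 < ν.M₁`; AUDIT-CLEAN of the uniqueness clause, bus DAGN12C-G30) — [15] Thm 1's existence of the minimal orbit ∕ uniqueness modulo tower-central gauges over class (6) on the support of
record, `Prop`s with parameters, NEVER asserted, NO producer (orphan edge N07→N12; the plan files the producer item against the GUARDED name).  THIS FILE displays them BY NAME:
§1 ★★★★★ the head from `(h15 : VariationalThm1RegSepCoP7MG F 2 A‴ B₃ a₀ a₁)` + `(hEU : VariationalThm1EUSepCoP7MG F 2 A‴ B₃ a₀ a₁)` (SAME guard `A‴(c′, c₀, c₁)`, the three guard rows displayed once)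
— N12's (J0′) row with ZERO anonymous [15] letters and the WEAKEST tokens (both guarded, both in the K0 road's registered currency); §2 ★★★ the same from `K0V22ZDefs.Prop8StepCoPGridGAt F` (= the
registered `stub_prop8StepCoPGridG13` signature at `F` = the K1 face of record's K0 hypothesis `h1G3 F`): the stub's constants `(c′, c₀, c₁, B₃, a₀, a₁)` come FIRST, then
`VariationalThm1EUSepCoP7MG F 2 A‴ B₃ a₀ a₁ →` the head for every instance passing the rows; §3 ★★ the head from `h15` + the FLOOR-FREE name `VariationalThm1EUSepCoP7M F 2 B₃ a₀ a₁`
(a floor-free fact serves every guard: the `Adm` antecedent dropped by one `fun`).  Proofs: ✓p741587 §1 with the named hypotheses handed over binder by binder (the lane's `def` bodies and this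
seat's guard-generic sentence agree up to `β`∕`δ`-unfolding: `Sup ν K s.Ω` at `Sup := suppDomOfRecord`, `SU 2` = `SU2`).

HONEST FRAMING ∕ LOCATED.  Compositions by name; all named facts are HYPOTHESES (K0⁷ OPEN; the (E∕U) facts have no producer); nothing of Bałaban's asserted; N12 NOT discharged; K0⁷ ∕
K1⁹ NOT closed; counts unmoved (typed 28∕28 · discharged 8∕27, A 8∕28); one finite 𝕋⁴ programme at fixed `ε = L^{-K}` — R4 closes only the conditional rung `BalabanLadder.UV`; no summit
statement is proved here and NOT the Yang–Mills mass gap (Clay); nothing continuum ∕ ℝ⁴ ∕ OS.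
-/

noncomputable section

namespace Summit.QuantumFields.YangMills.BalabanUVNodes.N12MinimiserFamilyKnitRowOfK0GridGNamedEUOnZOfRecord

open scoped BigOperators Matrix.Norms.L2Operator Topology
open Literature.MathematicalPhysics.QuantumFieldTheory.Balaban1983to89
open T4Continuum
open B15DeterminingSets GaugeField
open ExpMeanLog (expMeanLogSU deltaSU)
open T4AdjointCovarianceUnitary (lieSU)
open Node00
open B15Prop1AnalyticExtClause (cplxVec)
open B15Prop1ChartCalculusSU2 (E3)
open T4CubeChartGnomonic (SU2)
open B14.Eq213DetSet (Bj maxDomT)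
open B14.Eq213MaximalDomains (side)
open B14.Eq22Determines (IsBlockUnion)
open B14.Eq216Concrete (feeds)
open B5Eq118OneStroke (iterBlockOf)
open B15Eq112TorusCover (lift)
open T4AxialGaugeSmallField (boxPlaqs castSite)
open B15Prop1Carrier (plaqsInside)
open Literature.MathematicalPhysics.QuantumFieldTheory.BalabanImbrieJaffe1984to88.BIJ85Eq453GaugeField (qsstarGIter0)
open B15ShellGauge193 (shellGauge)
open B15Extension193 (extend)
open B16Sect1Backgrounds (toMS expMul)
open B15Prop1ChartSU2 (su2Chart)
open Metric (ball)
open T4AxialGaugeSmallField (boxBonds)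
open Summit.QuantumFields.YangMills.BalabanUVNodes.N07Thm1Top7FromProp8 (variationalThm1RegSepCoP7MG_of_prop8TopStepG)
open Summit.QuantumFields.YangMills.Theorems.K0V22ZDefs (Prop8StepCoPGridGAt)
open Summit.QuantumFields.YangMills.BalabanUVNodes.N12MinimiserFamilyKnitRowOfK0GridGOnZOfRecord (exists_R_hMinRow_of_variationalThm1RegSepCoP7MG_grid_alongOrbit_onZ_ofRecord)
open B11Thm1ExistsUniqueCoP7M (VariationalThm1EUSepCoP7M)
open B11Thm1ExistsUniqueCoP7MG (VariationalThm1EUSepCoP7MG)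

variable {F : T4Family} {k : ℕ}

/-! ## §1  The head from the TWO GUARDED NAMED FACTS — K0⁷'s grid-guarded (8)-sentence + the lane's guarded (E∕U) fact, same guard `A‴` -/

/-- ★★★★★ **THE KNIT's (J0′) ROW OF RECORD FROM TWO NAMED [15]-THEOREM-1 FACTS IN THE K0 ROAD's REGISTERED CURRENCY — ZERO ANONYMOUS LETTERS**: ✓p741587 §1 with its guard-generic (E∕U)
sentence served BY NAME by `(hEU : VariationalThm1EUSepCoP7MG F 2 A‴(c′,c₀,c₁) B₃ a₀ a₁)` (the lane dag-n12-c g30's guarded named fact; binder positions = K0⁷'s `…RegSepCoP7MG`'s, so the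
hand-over is binder by binder).  Displayed: record numerics, (σ)_N numerics, the three grid-guard rows `c′ ≤ ν.M₁` ∕ `k + c₀ ≤ m + Kt` ∕ `L^{c₁} ∣ ν.M₁`,
`(h15 : Node00.VariationalThm1RegSepCoP7MG F 2 A‴ B₃ a₀ a₁)`, `hEU`; conclusion VERBATIM.  «INHABITED BY»: `h15` — OPEN = K0⁷ stmt-QuantumFields-20541's registered stub 1 through dag-n07-e's guarded
bridge (§2 displays that text); `hEU` — OPEN, NO producer in the tree (orphan edge N07→N12; AUDIT-CLEAN as typed, DAGN12C-G30).
[cite: Balaban1985Variational, (1) p.277, (2)–(7) p.278, Thm 1 (8) p.279, p.304 lines 1–2, Prop. 8 p.304, Sect. G pp.305–307, Prop. 9 (190) p.309; Balaban1989LargeFieldI, (i) p.177, (1.74) p.192, p.193 L14–20, Prop. 1 p.194; Balaban1985RegularSpaces, (1.3)–(1.9) p.77; Balaban1989LargeFieldII, (1.12)–(1.13) p.359; Balaban1988Convergent, (2.1)–(2.2) pp.254–255, (2.5) p.255, (2.10)–(2.13) pp.256–257, (2.17)–(2.18) p.257; Balaban1985Averaging, (8)–(9) pp.18–19, Prop.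 2 (52)–(54) p.26, (122)–(126) p.36; Balaban1987RG1, (0.1) p.251, (0.4) p.253] -/
theorem exists_R_hMinRow_of_variationalThm1RegSepCoP7MG_grid_of_EUSepCoP7MG_grid_alongOrbit_onZ_ofRecord (ν : Node00.Stage7Numerics) (Kt : ℕ) (hd3 : 3 ≤ (F.P Kt).d) (Z : Set (Site (F.P Kt) 0))
    (hkK : k + 1 ≤ (F.P Kt).m + (F.P Kt).K) (hk1 : 1 ≤ k) (hdiv : side (F.P Kt).L ν.M₁ k ∣ (F.P Kt).sitesPerDir 0) (hfloor : ((F.P Kt).d + 14) * (F.P Kt).L ≤ ν.M₁) (hZblk : IsBlockUnion k Z)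
    -- (σ)_N OF RECORD, onZ EDITION (dag-n12-w6 g18's `N12GaugeLetterLocExplicitOnZ.exists_gaugeLetterLoc_atRecord_explicit_onZ` inside the lane's U3-onZ), instance-level NUMERICS verbatim:
    -- NUMERICS (i): a level guard `k + c ≤ m + K` with `4d + m′ + 3 < 2·L^c` (no wrapping), and `M₁ ≥ (4d + m′)·L² + 2d·L + 12` (radii), `m′ = 3·(d·((L−1)∕2)) + 5`
    {c : ℕ} (hkc : k + c ≤ (F.P Kt).m + (F.P Kt).K) (hc : 4 * (F.P Kt).d + (3 * ((F.P Kt).d * (((F.P Kt).L - 1) / 2)) + 5) + 3 < 2 * (F.P Kt).L ^ c)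
    (hMrad : (4 * (F.P Kt).d + (3 * ((F.P Kt).d * (((F.P Kt).L - 1) / 2)) + 5)) * (F.P Kt).L ^ 2 + 2 * (F.P Kt).d * (F.P Kt).L + 12 ≤ ν.M₁)
    -- the family's support numerics: `M₁ ≥ ((d+4)L + 6)·L²`
    (hM₁ : (((F.P Kt).d + 4) * (F.P Kt).L + 6) * (F.P Kt).L ^ 2 ≤ ν.M₁)
    -- THE K0 ROAD's GRID GUARD `A‴(c′, c₀, c₁)` AT THIS INSTANCE (K0⁷ V22-Z, `K0V22ZDefs.Prop8StepCoPGridGAt`): numerics floor, level guard, granularity (the fourth conjunct is `hdiv` along `g ≡ 1`)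
    {c' c₀ c₁ : ℕ} (hc' : c' ≤ ν.M₁) (hkc₀ : k + c₀ ≤ F.m + Kt) (hc₁ : F.L ^ c₁ ∣ ν.M₁)
    {B₃ a₀ a₁ : ℝ}
    -- [15] THEOREM 1 (R) = (8): THE GRID-GUARDED SENTENCE IN NODE 00's HOUSE — K0⁷ stub 3ᴬ′-G‴-Z's antecedent text ∕ the output of dag-n07-e's `variationalThm1RegSepCoP7MG_of_prop8TopStepG` on the
    -- registered stub-1 text.  «INHABITED BY»: OPEN — K0⁷ stmt-QuantumFields-20541 (`stub_prop8StepCoPGridG13`; §2 keys on that text itself)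
    (h15 : VariationalThm1RegSepCoP7MG F 2
      (fun ν M g K k _s => c' ≤ ν.M₁ ∧ k + c₀ ≤ F.m + K ∧ F.L ^ c₁ ∣ M ∧
        ∀ i, 1 ≤ i → i ≤ k → dCubeSide (F.P K).L M (RkOfRecord (F.P K).L ν.r (g i)) i ∣ (F.P K).sitesPerDir 0) B₃ a₀ a₁)
    -- [15] THEOREM 1, EXISTENCE OF THE MINIMAL ORBIT ∕ UNIQUENESS MODULO TOWER-CENTRAL GAUGES — THE LANE's GUARDED NAMED FACT at the SAME guard `A‴(c′, c₀, c₁)`, lengths `0 < k`.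
    -- «INHABITED BY»: OPEN — NO producer in the tree (orphan edge N07→N12; the plan files the producer item against this name)
    (hEU : VariationalThm1EUSepCoP7MG F 2
      (fun ν M g K k _s => c' ≤ ν.M₁ ∧ k + c₀ ≤ F.m + K ∧ F.L ^ c₁ ∣ M ∧
        ∀ i, 1 ≤ i → i ≤ k → dCubeSide (F.P K).L M (RkOfRecord (F.P K).L ν.r (g i)) i ∣ (F.P K).sitesPerDir 0) B₃ a₀ a₁) :
    -- the per-height letters DISCHARGED (dag-n12-w6 `N12HsurjOfClass.exists_hsurjLetters`): the radius `ρ″` and the window tolerance `εH` announced from (instance, height) alone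
    ∃ ρ'' εH : ℝ, 0 < ρ'' ∧ 0 < εH ∧
    ∃ δ₀ : ℝ, 0 < δ₀ ∧
    ∀ (Λ : Set (Site (F.P Kt) 0)) (lo hi : Fin (F.P Kt).d → ℤ) (eR : ℝ), 0 < eR →
    ∀ (n : ℕ), (∀ κ, hi κ ≤ lo κ + n) → (∀ κ, ((hi κ - lo κ + 1).toNat : ℤ) + 5 < ((F.P Kt).sitesPerDir k : ℤ)) → lo ≤ hi →
      pts k Λ = (castSite '' Set.Icc lo hi : Set (Site (F.P Kt) k)) → (boxPlaqs (lo - 1) (hi + 1) : Set (Plaq (F.P Kt) k)) ⊆ plaqsInside (pts k Z) →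
    -- THE REGION BOX of the direct road (dag-n12-w6 §7's big box): `LO ≤ lo − 1`, `hi + 1 ≤ HI`, side budget `n′ < sitesPerDir k`, its plaquettes inside `Z^{(k)}`, and BOX SCOPE: every `k`-bond inside `Z^{(k)}` is a bond of the box
    -- (= print's STANDING shape condition on the class-(i) large-field components: [Balaban1988Convergent] p.255 after (2.3) «if a component of Z_j is contained in a cube of the size
    -- 100MR_j, then it is a rectangular parallelepiped», [Balaban1989LargeFieldI] (i) p.177 — lit-balaban ME #45∕#46; not a narrowing of print's instance family)
    ∀ (LO HI : Fin (F.P Kt).d → ℤ) (n' : ℕ), LO ≤ lo - 1 → hi + 1 ≤ HI → (∀ κ, HI κ ≤ LO κ + n') → n' < (F.P Kt).sitesPerDir k →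
      (boxPlaqs LO HI : Set (Plaq (F.P Kt) k)) ⊆ plaqsInside (pts k Z) → {e : PBond (F.P Kt) k | e.src ∈ pts k Z ∧ e.tgt ∈ pts k Z} ⊆ boxBonds LO HI →
    ∀ {cE : ℝ}, 12 * ((F.P Kt).d : ℝ) * ((n : ℝ) + 2) ^ 2 ≤ cE → 6 * ((((F.P Kt).d - 1 : ℕ)) : ℝ) * (F.P Kt).L ^ k * (2 * ((cE + 1) * eR)) ≤ ρ'' →
    ∀ (ext : GaugeField (F.P Kt) k SU2 → GaugeField (F.P Kt) k SU2), (∀ W, ext W = extend (pts k Λ) (shellGauge W lo hi) W) →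
    ∀ {𝓐₀ : ℝ}, 1 < 𝓐₀ →
    ∀ (εr : ℝ), 0 < εr → 12 * ((((F.P Kt).d - 1 : ℕ)) : ℝ) * (F.P Kt).L * εr ≤ ρ'' → εr ≤ εH →
      (143 * (((((F.P Kt).d + 4 : ℕ) : ℝ)) ^ 2 / 4) ^ 2) * (2 * ((F.P Kt).L : ℝ) ^ 2 * εr) ≤ 1 / 3 →
      2 * (2 * ((F.P Kt).L : ℝ) ^ 2 * εr) ≤ 2 * deltaSU (Fin 2) / ((((F.P Kt).d + 4) * (F.P Kt).L : ℕ) : ℝ) ^ 2 →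
    -- [15]'s comparability rows at `ε := 2eR`
    ∀ {ε₀ : ℝ}, (cE + 1) * (2 * eR) ≤ a₁ → B₃ * ((cE + 1) * (2 * eR)) ≤ εr → εr < ε₀ → ε₀ ≤ a₀ →
    -- the datum bond tolerance `ρn` with U3's «`T(ρn, εr) ≤ δ₀`» row (VERBATIM)
    ∀ {ρn : ℝ}, 0 ≤ ρn →
    (max ρn ((((2 * (∑ i ∈ Finset.range (k + 1), ((F.P Kt).d * (((F.P Kt).L ^ i - 1) / 2) + 1)) + 1 +
                  (3 * ((F.P Kt).d * (((F.P Kt).L - 1) / 2)) + 5) * (F.P Kt).L ^ k : ℕ) : ℝ)) ^ 2 / 4 * (εr * (F.P Kt).eta 0 ^ 2) +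
                ((3 * ((F.P Kt).d * (((F.P Kt).L - 1) / 2)) + 5 : ℕ) : ℝ) * (6 * ((((((F.P Kt).d + 2) * (F.P Kt).L : ℕ) : ℝ) ^ 2 / 4) * (2 * (εr * (F.P Kt).L ^ 2))) * ∑ i ∈ Finset.range k, ((F.P Kt).L : ℝ) ^ i) + ((3 * ((F.P Kt).d * (((F.P Kt).L - 1) / 2)) + 5 : ℕ) : ℝ) * ρn) ≤ δ₀) →
    -- the normaliser's bond tolerance (dag-n12-w6 §7, at `ε := eR`) below the datum tolerance `ρn`
    (((F.P Kt).d : ℝ) * n' + 1) * ((((F.P Kt).d - 1 : ℕ) : ℝ) * n' * ((12 * (F.P Kt).d * (n + 2) ^ 2 + 1) * eR) + 3 * (F.P Kt).d * (n + 2) ^ 2 * eR) ≤ ρn →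
    -- NO PER-BASE-FIELD HYPOTHESIS AND NO ANTECEDENT: the knit's `hMin` ∀-body for EVERY base field of the strict guard, bound `4𝓐₀`
    ∃ R : ℝ, 0 < R ∧ ∀ Vk : GaugeField (F.P Kt) k SU2, PlaqSmallOn (plaqsInside (pts k (Z ∩ Λᶜ))) eR Vk →
      ∃ Ũ : VecField (F.P Kt) k (EuclideanSpace ℂ (Fin 3)) × VecField (F.P Kt) k (EuclideanSpace ℂ (Fin 3)) → PBond (F.P Kt) 0 → Matrix (Fin 2) (Fin 2) ℂ,
        (∀ b i j, DifferentiableOn ℂ (fun z => Ũ z b i j) (ball 0 R)) ∧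
        (∀ z ∈ ball (0 : VecField (F.P Kt) k (EuclideanSpace ℂ (Fin 3)) × VecField (F.P Kt) k (EuclideanSpace ℂ (Fin 3))) R, ∀ b i j, ‖Ũ z b i j‖ ≤ 4 * 𝓐₀) ∧
        ∀ p B' : VecField (F.P Kt) k E3, ‖p‖ < R → ‖B'‖ < R → ∃ U' : GaugeField (F.P Kt) 0 SU2,
          (∀ b, Ũ (cplxVec p, cplxVec B') b = ((U' b : SU2) : Matrix (Fin 2) (Fin 2) ℂ)) ∧
            IsMinimizer (Node00.avOfRecord F 2 Kt) (Node00.regMSCoPOfRecord F 2 {ν with εreg := εr} Kt k (maxDomT ν.M₁ Z)) (Bj ν.M₁ Z k)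
              (avgFamily (Node00.avOfRecord F 2 Kt) (qsstarGIter0 k (expMul su2Chart B' (ext (expMul su2Chart p Vk))))) U' :=
  exists_R_hMinRow_of_variationalThm1RegSepCoP7MG_grid_alongOrbit_onZ_ofRecord ν Kt hd3 Z hkK hk1 hdiv hfloor hZblk hkc hc hMrad hM₁ hc' hkc₀ hc₁ h15
    fun ν' M g K k' s hk' hsep hM₁' hadm => hEU ν' M g K k' s hk' hsep hM₁' hadm

/-! ## §2  The same from K0⁷'s REGISTERED stub-1 text + the guarded (E∕U) name at the stub's constants -/

/-- ★★★ **THE KNIT's (J0′) ROW OF RECORD FROM K0⁷'s REGISTERED STUB-1 TEXT AND THE GUARDED NAMED (E∕U) FACT** — `K0V22ZDefs.Prop8StepCoPGridGAt F` (= the registered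
`stub_prop8StepCoPGridG13` signature at `F`; the K1 face of record's K0 hypothesis `h1G3 F`) yields the stub's constants `(c′, c₀, c₁, B₃, a₀, a₁)` FIRST (`2L² ≤ B₃`, `0 < a₀`, `0 < a₁`);
then, GIVEN `VariationalThm1EUSepCoP7MG F 2 A‴(c′,c₀,c₁) B₃ a₀ a₁` AT THOSE CONSTANTS AND THAT GUARD (the one inner antecedent; orphan, no producer), §1 for every instance passing the record
numerics, the (σ)_N numerics and the three guard rows — conclusion VERBATIM.  Route: `variationalThm1RegSepCoP7MG_of_prop8TopStepG` (`0 < B₃` from `2L² ≤ B₃`) then §1.  CONDITIONAL on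
both named texts (K0⁷ OPEN; (E∕U) no producer); nothing of Bałaban's asserted.
[cite: Balaban1985Variational, (1) p.277, (2)–(7) p.278, Thm 1 (8) p.279, p.304 lines 1–2, Prop. 8 p.304, Sect. G pp.305–307, Prop. 9 (190) p.309; Balaban1989LargeFieldI, (i) p.177, (1.74) p.192, p.193 L14–20, Prop. 1 p.194; Balaban1985RegularSpaces, (1.3)–(1.9) p.77; Balaban1989LargeFieldII, (1.12)–(1.13) p.359; Balaban1988Convergent, (2.1)–(2.2) pp.254–255, (2.5) p.255, (2.10)–(2.13) pp.256–257, (2.17)–(2.18) p.257; Balaban1985Averaging, (8)–(9) pp.18–19, Prop. 2 (52)–(54) p.26, (122)–(126) p.36; Balaban1987RG1, (0.1) p.251, (0.4) p.253] -/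
theorem exists_R_hMinRow_of_prop8StepCoPGridGAt_of_EUSepCoP7MG_grid_alongOrbit_onZ_ofRecord (h1 : Prop8StepCoPGridGAt F) :
    ∃ (c' c₀ c₁ : ℕ) (B₃ a₀ a₁ : ℝ), 2 * (F.L : ℝ) ^ 2 ≤ B₃ ∧ 0 < a₀ ∧ 0 < a₁ ∧
    (VariationalThm1EUSepCoP7MG F 2
      (fun ν M g K k _s => c' ≤ ν.M₁ ∧ k + c₀ ≤ F.m + K ∧ F.L ^ c₁ ∣ M ∧
        ∀ i, 1 ≤ i → i ≤ k → dCubeSide (F.P K).L M (RkOfRecord (F.P K).L ν.r (g i)) i ∣ (F.P K).sitesPerDir 0) B₃ a₀ a₁ →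
    ∀ (ν : Node00.Stage7Numerics) (Kt : ℕ), 3 ≤ (F.P Kt).d → ∀ (Z : Set (Site (F.P Kt) 0)) (k : ℕ),
      k + 1 ≤ (F.P Kt).m + (F.P Kt).K → 1 ≤ k → side (F.P Kt).L ν.M₁ k ∣ (F.P Kt).sitesPerDir 0 → ((F.P Kt).d + 14) * (F.P Kt).L ≤ ν.M₁ → IsBlockUnion k Z → ∀ {c : ℕ},
      k + c ≤ (F.P Kt).m + (F.P Kt).K → 4 * (F.P Kt).d + (3 * ((F.P Kt).d * (((F.P Kt).L - 1) / 2)) + 5) + 3 < 2 * (F.P Kt).L ^ c →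
      (4 * (F.P Kt).d + (3 * ((F.P Kt).d * (((F.P Kt).L - 1) / 2)) + 5)) * (F.P Kt).L ^ 2 + 2 * (F.P Kt).d * (F.P Kt).L + 12 ≤ ν.M₁ →
      (((F.P Kt).d + 4) * (F.P Kt).L + 6) * (F.P Kt).L ^ 2 ≤ ν.M₁ →
    -- the three grid-guard rows at this instance
      c' ≤ ν.M₁ → k + c₀ ≤ F.m + Kt → F.L ^ c₁ ∣ ν.M₁ →
    -- the per-height letters DISCHARGED (dag-n12-w6 `N12HsurjOfClass.exists_hsurjLetters`): the radius `ρ″` and the window tolerance `εH` announced from (instance, height) alone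
    ∃ ρ'' εH : ℝ, 0 < ρ'' ∧ 0 < εH ∧
    ∃ δ₀ : ℝ, 0 < δ₀ ∧
    ∀ (Λ : Set (Site (F.P Kt) 0)) (lo hi : Fin (F.P Kt).d → ℤ) (eR : ℝ), 0 < eR →
    ∀ (n : ℕ), (∀ κ, hi κ ≤ lo κ + n) → (∀ κ, ((hi κ - lo κ + 1).toNat : ℤ) + 5 < ((F.P Kt).sitesPerDir k : ℤ)) → lo ≤ hi →
      pts k Λ = (castSite '' Set.Icc lo hi : Set (Site (F.P Kt) k)) → (boxPlaqs (lo - 1) (hi + 1) : Set (Plaq (F.P Kt) k)) ⊆ plaqsInside (pts k Z) →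
    -- THE REGION BOX of the direct road (dag-n12-w6 §7's big box): `LO ≤ lo − 1`, `hi + 1 ≤ HI`, side budget `n′ < sitesPerDir k`, its plaquettes inside `Z^{(k)}`, and BOX SCOPE: every `k`-bond inside `Z^{(k)}` is a bond of the box
    -- (= print's STANDING shape condition on the class-(i) large-field components: [Balaban1988Convergent] p.255 after (2.3) «if a component of Z_j is contained in a cube of the size
    -- 100MR_j, then it is a rectangular parallelepiped», [Balaban1989LargeFieldI] (i) p.177 — lit-balaban ME #45∕#46; not a narrowing of print's instance family)
    ∀ (LO HI : Fin (F.P Kt).d → ℤ) (n' : ℕ), LO ≤ lo - 1 → hi + 1 ≤ HI → (∀ κ, HI κ ≤ LO κ + n') → n' < (F.P Kt).sitesPerDir k →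
      (boxPlaqs LO HI : Set (Plaq (F.P Kt) k)) ⊆ plaqsInside (pts k Z) → {e : PBond (F.P Kt) k | e.src ∈ pts k Z ∧ e.tgt ∈ pts k Z} ⊆ boxBonds LO HI →
    ∀ {cE : ℝ}, 12 * ((F.P Kt).d : ℝ) * ((n : ℝ) + 2) ^ 2 ≤ cE → 6 * ((((F.P Kt).d - 1 : ℕ)) : ℝ) * (F.P Kt).L ^ k * (2 * ((cE + 1) * eR)) ≤ ρ'' →
    ∀ (ext : GaugeField (F.P Kt) k SU2 → GaugeField (F.P Kt) k SU2), (∀ W, ext W = extend (pts k Λ) (shellGauge W lo hi) W) →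
    ∀ {𝓐₀ : ℝ}, 1 < 𝓐₀ →
    ∀ (εr : ℝ), 0 < εr → 12 * ((((F.P Kt).d - 1 : ℕ)) : ℝ) * (F.P Kt).L * εr ≤ ρ'' → εr ≤ εH →
      (143 * (((((F.P Kt).d + 4 : ℕ) : ℝ)) ^ 2 / 4) ^ 2) * (2 * ((F.P Kt).L : ℝ) ^ 2 * εr) ≤ 1 / 3 →
      2 * (2 * ((F.P Kt).L : ℝ) ^ 2 * εr) ≤ 2 * deltaSU (Fin 2) / ((((F.P Kt).d + 4) * (F.P Kt).L : ℕ) : ℝ) ^ 2 →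
    -- [15]'s comparability rows at `ε := 2eR`
    ∀ {ε₀ : ℝ}, (cE + 1) * (2 * eR) ≤ a₁ → B₃ * ((cE + 1) * (2 * eR)) ≤ εr → εr < ε₀ → ε₀ ≤ a₀ →
    -- the datum bond tolerance `ρn` with U3's «`T(ρn, εr) ≤ δ₀`» row (VERBATIM)
    ∀ {ρn : ℝ}, 0 ≤ ρn →
    (max ρn ((((2 * (∑ i ∈ Finset.range (k + 1), ((F.P Kt).d * (((F.P Kt).L ^ i - 1) / 2) + 1)) + 1 +
                  (3 * ((F.P Kt).d * (((F.P Kt).L - 1) / 2)) + 5) * (F.P Kt).L ^ k : ℕ) : ℝ)) ^ 2 / 4 * (εr * (F.P Kt).eta 0 ^ 2) +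
                ((3 * ((F.P Kt).d * (((F.P Kt).L - 1) / 2)) + 5 : ℕ) : ℝ) * (6 * ((((((F.P Kt).d + 2) * (F.P Kt).L : ℕ) : ℝ) ^ 2 / 4) * (2 * (εr * (F.P Kt).L ^ 2))) * ∑ i ∈ Finset.range k, ((F.P Kt).L : ℝ) ^ i) + ((3 * ((F.P Kt).d * (((F.P Kt).L - 1) / 2)) + 5 : ℕ) : ℝ) * ρn) ≤ δ₀) →
    -- the normaliser's bond tolerance (dag-n12-w6 §7, at `ε := eR`) below the datum tolerance `ρn`
    (((F.P Kt).d : ℝ) * n' + 1) * ((((F.P Kt).d - 1 : ℕ) : ℝ) * n' * ((12 * (F.P Kt).d * (n + 2) ^ 2 + 1) * eR) + 3 * (F.P Kt).d * (n + 2) ^ 2 * eR) ≤ ρn →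
    -- NO PER-BASE-FIELD HYPOTHESIS AND NO ANTECEDENT: the knit's `hMin` ∀-body for EVERY base field of the strict guard, bound `4𝓐₀`
    ∃ R : ℝ, 0 < R ∧ ∀ Vk : GaugeField (F.P Kt) k SU2, PlaqSmallOn (plaqsInside (pts k (Z ∩ Λᶜ))) eR Vk →
      ∃ Ũ : VecField (F.P Kt) k (EuclideanSpace ℂ (Fin 3)) × VecField (F.P Kt) k (EuclideanSpace ℂ (Fin 3)) → PBond (F.P Kt) 0 → Matrix (Fin 2) (Fin 2) ℂ,
        (∀ b i j, DifferentiableOn ℂ (fun z => Ũ z b i j) (ball 0 R)) ∧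
        (∀ z ∈ ball (0 : VecField (F.P Kt) k (EuclideanSpace ℂ (Fin 3)) × VecField (F.P Kt) k (EuclideanSpace ℂ (Fin 3))) R, ∀ b i j, ‖Ũ z b i j‖ ≤ 4 * 𝓐₀) ∧
        ∀ p B' : VecField (F.P Kt) k E3, ‖p‖ < R → ‖B'‖ < R → ∃ U' : GaugeField (F.P Kt) 0 SU2,
          (∀ b, Ũ (cplxVec p, cplxVec B') b = ((U' b : SU2) : Matrix (Fin 2) (Fin 2) ℂ)) ∧
            IsMinimizer (Node00.avOfRecord F 2 Kt) (Node00.regMSCoPOfRecord F 2 {ν with εreg := εr} Kt k (maxDomT ν.M₁ Z)) (Bj ν.M₁ Z k)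
              (avgFamily (Node00.avOfRecord F 2 Kt) (qsstarGIter0 k (expMul su2Chart B' (ext (expMul su2Chart p Vk))))) U') := by
  obtain ⟨c', c₀, c₁, B₃, a₀, a₁, hB₃, ha₀, ha₁, h8⟩ := h1
  have hL : (1 : ℝ) ≤ F.L := by exact_mod_cast F.hL.2.le
  have hB : 0 < B₃ := lt_of_lt_of_le (by positivity) hB₃
  refine ⟨c', c₀, c₁, B₃, a₀, a₁, hB₃, ha₀, ha₁, ?_⟩
  intro hEU ν Kt hd3 Z k hkK hk1 hdiv hfloor hZblk c hkc hc hMrad hM₁ hc' hkc₀ hc₁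
  exact exists_R_hMinRow_of_variationalThm1RegSepCoP7MG_grid_of_EUSepCoP7MG_grid_alongOrbit_onZ_ofRecord ν Kt hd3 Z hkK hk1 hdiv hfloor hZblk hkc hc hMrad hM₁ hc' hkc₀ hc₁
    (variationalThm1RegSepCoP7MG_of_prop8TopStepG hB h8) hEU

/-! ## §3  The head from K0⁷'s grid-guarded (8)-sentence + the lane's FLOOR-FREE (E∕U) name (a floor-free fact serves every guard) -/

/-- ★★ **THE SAME WITH THE FLOOR-FREE (E∕U) NAME** `(hEU : VariationalThm1EUSepCoP7M F 2 B₃ a₀ a₁)` (dag-n12-c g29 ✓p740853; AUDIT-CLEAN): the guard antecedent is dropped by one `fun`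
(floor-free ⇒ guarded), then §1.  The STRONGER display of the (E∕U) half; §1 is the weakest-token form. «INHABITED BY»: `h15` OPEN (K0⁷); `hEU` OPEN (no producer).
[cite: Balaban1985Variational, (1) p.277, (2)–(7) p.278, Thm 1 (8) p.279, p.304 lines 1–2, Prop. 8 p.304, Sect. G pp.305–307, Prop. 9 (190) p.309; Balaban1989LargeFieldI, (i) p.177, (1.74) p.192, p.193 L14–20, Prop. 1 p.194; Balaban1985RegularSpaces, (1.3)–(1.9) p.77; Balaban1989LargeFieldII, (1.12)–(1.13) p.359; Balaban1988Convergent, (2.1)–(2.2) pp.254–255, (2.5) p.255, (2.10)–(2.13) pp.256–257, (2.17)–(2.18) p.257; Balaban1985Averaging, (8)–(9) pp.18–19, Prop. 2 (52)–(54) p.26, (122)–(126) p.36; Balaban1987RG1, (0.1) p.251, (0.4) p.253] -/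
theorem exists_R_hMinRow_of_variationalThm1RegSepCoP7MG_grid_of_EUSepCoP7M_alongOrbit_onZ_ofRecord (ν : Node00.Stage7Numerics) (Kt : ℕ) (hd3 : 3 ≤ (F.P Kt).d) (Z : Set (Site (F.P Kt) 0))
    (hkK : k + 1 ≤ (F.P Kt).m + (F.P Kt).K) (hk1 : 1 ≤ k) (hdiv : side (F.P Kt).L ν.M₁ k ∣ (F.P Kt).sitesPerDir 0) (hfloor : ((F.P Kt).d + 14) * (F.P Kt).L ≤ ν.M₁) (hZblk : IsBlockUnion k Z)
    -- (σ)_N OF RECORD, onZ EDITION (dag-n12-w6 g18's `N12GaugeLetterLocExplicitOnZ.exists_gaugeLetterLoc_atRecord_explicit_onZ` inside the lane's U3-onZ), instance-level NUMERICS verbatim: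
    -- NUMERICS (i): a level guard `k + c ≤ m + K` with `4d + m′ + 3 < 2·L^c` (no wrapping), and `M₁ ≥ (4d + m′)·L² + 2d·L + 12` (radii), `m′ = 3·(d·((L−1)∕2)) + 5`
    {c : ℕ} (hkc : k + c ≤ (F.P Kt).m + (F.P Kt).K) (hc : 4 * (F.P Kt).d + (3 * ((F.P Kt).d * (((F.P Kt).L - 1) / 2)) + 5) + 3 < 2 * (F.P Kt).L ^ c)
    (hMrad : (4 * (F.P Kt).d + (3 * ((F.P Kt).d * (((F.P Kt).L - 1) / 2)) + 5)) * (F.P Kt).L ^ 2 + 2 * (F.P Kt).d * (F.P Kt).L + 12 ≤ ν.M₁)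
    -- the family's support numerics: `M₁ ≥ ((d+4)L + 6)·L²`
    (hM₁ : (((F.P Kt).d + 4) * (F.P Kt).L + 6) * (F.P Kt).L ^ 2 ≤ ν.M₁)
    -- THE K0 ROAD's GRID GUARD `A‴(c′, c₀, c₁)` AT THIS INSTANCE (K0⁷ V22-Z, `K0V22ZDefs.Prop8StepCoPGridGAt`): numerics floor, level guard, granularity (the fourth conjunct is `hdiv` along `g ≡ 1`)
    {c' c₀ c₁ : ℕ} (hc' : c' ≤ ν.M₁) (hkc₀ : k + c₀ ≤ F.m + Kt) (hc₁ : F.L ^ c₁ ∣ ν.M₁)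
    {B₃ a₀ a₁ : ℝ}
    -- [15] THEOREM 1 (R) = (8): THE GRID-GUARDED SENTENCE IN NODE 00's HOUSE — K0⁷ stub 3ᴬ′-G‴-Z's antecedent text ∕ the output of dag-n07-e's `variationalThm1RegSepCoP7MG_of_prop8TopStepG` on the
    -- registered stub-1 text.  «INHABITED BY»: OPEN — K0⁷ stmt-QuantumFields-20541 (`stub_prop8StepCoPGridG13`; §2 keys on that text itself)
    (h15 : VariationalThm1RegSepCoP7MG F 2
      (fun ν M g K k _s => c' ≤ ν.M₁ ∧ k + c₀ ≤ F.m + K ∧ F.L ^ c₁ ∣ M ∧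
        ∀ i, 1 ≤ i → i ≤ k → dCubeSide (F.P K).L M (RkOfRecord (F.P K).L ν.r (g i)) i ∣ (F.P K).sitesPerDir 0) B₃ a₀ a₁)
    -- [15] THEOREM 1, EXISTENCE OF THE MINIMAL ORBIT ∕ UNIQUENESS MODULO TOWER-CENTRAL GAUGES — THE LANE's FLOOR-FREE NAMED FACT (dag-n12-c g29 `B11Thm1ExistsUniqueCoP7M`), `0 < k`.
    -- «INHABITED BY»: OPEN — NO producer in the tree (orphan edge N07→N12)
    (hEU : VariationalThm1EUSepCoP7M F 2 B₃ a₀ a₁) :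
    -- the per-height letters DISCHARGED (dag-n12-w6 `N12HsurjOfClass.exists_hsurjLetters`): the radius `ρ″` and the window tolerance `εH` announced from (instance, height) alone
    ∃ ρ'' εH : ℝ, 0 < ρ'' ∧ 0 < εH ∧
    ∃ δ₀ : ℝ, 0 < δ₀ ∧
    ∀ (Λ : Set (Site (F.P Kt) 0)) (lo hi : Fin (F.P Kt).d → ℤ) (eR : ℝ), 0 < eR →
    ∀ (n : ℕ), (∀ κ, hi κ ≤ lo κ + n) → (∀ κ, ((hi κ - lo κ + 1).toNat : ℤ) + 5 < ((F.P Kt).sitesPerDir k : ℤ)) → lo ≤ hi →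
      pts k Λ = (castSite '' Set.Icc lo hi : Set (Site (F.P Kt) k)) → (boxPlaqs (lo - 1) (hi + 1) : Set (Plaq (F.P Kt) k)) ⊆ plaqsInside (pts k Z) →
    -- THE REGION BOX of the direct road (dag-n12-w6 §7's big box): `LO ≤ lo − 1`, `hi + 1 ≤ HI`, side budget `n′ < sitesPerDir k`, its plaquettes inside `Z^{(k)}`, and BOX SCOPE: every `k`-bond inside `Z^{(k)}` is a bond of the box
    -- (= print's STANDING shape condition on the class-(i) large-field components: [Balaban1988Convergent] p.255 after (2.3) «if a component of Z_j is contained in a cube of the size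
    -- 100MR_j, then it is a rectangular parallelepiped», [Balaban1989LargeFieldI] (i) p.177 — lit-balaban ME #45∕#46; not a narrowing of print's instance family)
    ∀ (LO HI : Fin (F.P Kt).d → ℤ) (n' : ℕ), LO ≤ lo - 1 → hi + 1 ≤ HI → (∀ κ, HI κ ≤ LO κ + n') → n' < (F.P Kt).sitesPerDir k →
      (boxPlaqs LO HI : Set (Plaq (F.P Kt) k)) ⊆ plaqsInside (pts k Z) → {e : PBond (F.P Kt) k | e.src ∈ pts k Z ∧ e.tgt ∈ pts k Z} ⊆ boxBonds LO HI →
    ∀ {cE : ℝ}, 12 * ((F.P Kt).d : ℝ) * ((n : ℝ) + 2) ^ 2 ≤ cE → 6 * ((((F.P Kt).d - 1 : ℕ)) : ℝ) * (F.P Kt).L ^ k * (2 * ((cE + 1) * eR)) ≤ ρ'' →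
    ∀ (ext : GaugeField (F.P Kt) k SU2 → GaugeField (F.P Kt) k SU2), (∀ W, ext W = extend (pts k Λ) (shellGauge W lo hi) W) →
    ∀ {𝓐₀ : ℝ}, 1 < 𝓐₀ →
    ∀ (εr : ℝ), 0 < εr → 12 * ((((F.P Kt).d - 1 : ℕ)) : ℝ) * (F.P Kt).L * εr ≤ ρ'' → εr ≤ εH →
      (143 * (((((F.P Kt).d + 4 : ℕ) : ℝ)) ^ 2 / 4) ^ 2) * (2 * ((F.P Kt).L : ℝ) ^ 2 * εr) ≤ 1 / 3 →
      2 * (2 * ((F.P Kt).L : ℝ) ^ 2 * εr) ≤ 2 * deltaSU (Fin 2) / ((((F.P Kt).d + 4) * (F.P Kt).L : ℕ) : ℝ) ^ 2 →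
    -- [15]'s comparability rows at `ε := 2eR`
    ∀ {ε₀ : ℝ}, (cE + 1) * (2 * eR) ≤ a₁ → B₃ * ((cE + 1) * (2 * eR)) ≤ εr → εr < ε₀ → ε₀ ≤ a₀ →
    -- the datum bond tolerance `ρn` with U3's «`T(ρn, εr) ≤ δ₀`» row (VERBATIM)
    ∀ {ρn : ℝ}, 0 ≤ ρn →
    (max ρn ((((2 * (∑ i ∈ Finset.range (k + 1), ((F.P Kt).d * (((F.P Kt).L ^ i - 1) / 2) + 1)) + 1 +
                  (3 * ((F.P Kt).d * (((F.P Kt).L - 1) / 2)) + 5) * (F.P Kt).L ^ k : ℕ) : ℝ)) ^ 2 / 4 * (εr * (F.P Kt).eta 0 ^ 2) +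
                ((3 * ((F.P Kt).d * (((F.P Kt).L - 1) / 2)) + 5 : ℕ) : ℝ) * (6 * ((((((F.P Kt).d + 2) * (F.P Kt).L : ℕ) : ℝ) ^ 2 / 4) * (2 * (εr * (F.P Kt).L ^ 2))) * ∑ i ∈ Finset.range k, ((F.P Kt).L : ℝ) ^ i) + ((3 * ((F.P Kt).d * (((F.P Kt).L - 1) / 2)) + 5 : ℕ) : ℝ) * ρn) ≤ δ₀) →
    -- the normaliser's bond tolerance (dag-n12-w6 §7, at `ε := eR`) below the datum tolerance `ρn`
    (((F.P Kt).d : ℝ) * n' + 1) * ((((F.P Kt).d - 1 : ℕ) : ℝ) * n' * ((12 * (F.P Kt).d * (n + 2) ^ 2 + 1) * eR) + 3 * (F.P Kt).d * (n + 2) ^ 2 * eR) ≤ ρn →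
    -- NO PER-BASE-FIELD HYPOTHESIS AND NO ANTECEDENT: the knit's `hMin` ∀-body for EVERY base field of the strict guard, bound `4𝓐₀`
    ∃ R : ℝ, 0 < R ∧ ∀ Vk : GaugeField (F.P Kt) k SU2, PlaqSmallOn (plaqsInside (pts k (Z ∩ Λᶜ))) eR Vk →
      ∃ Ũ : VecField (F.P Kt) k (EuclideanSpace ℂ (Fin 3)) × VecField (F.P Kt) k (EuclideanSpace ℂ (Fin 3)) → PBond (F.P Kt) 0 → Matrix (Fin 2) (Fin 2) ℂ,
        (∀ b i j, DifferentiableOn ℂ (fun z => Ũ z b i j) (ball 0 R)) ∧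
        (∀ z ∈ ball (0 : VecField (F.P Kt) k (EuclideanSpace ℂ (Fin 3)) × VecField (F.P Kt) k (EuclideanSpace ℂ (Fin 3))) R, ∀ b i j, ‖Ũ z b i j‖ ≤ 4 * 𝓐₀) ∧
        ∀ p B' : VecField (F.P Kt) k E3, ‖p‖ < R → ‖B'‖ < R → ∃ U' : GaugeField (F.P Kt) 0 SU2,
          (∀ b, Ũ (cplxVec p, cplxVec B') b = ((U' b : SU2) : Matrix (Fin 2) (Fin 2) ℂ)) ∧
            IsMinimizer (Node00.avOfRecord F 2 Kt) (Node00.regMSCoPOfRecord F 2 {ν with εreg := εr} Kt k (maxDomT ν.M₁ Z)) (Bj ν.M₁ Z k)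
              (avgFamily (Node00.avOfRecord F 2 Kt) (qsstarGIter0 k (expMul su2Chart B' (ext (expMul su2Chart p Vk))))) U' :=
  exists_R_hMinRow_of_variationalThm1RegSepCoP7MG_grid_of_EUSepCoP7MG_grid_alongOrbit_onZ_ofRecord ν Kt hd3 Z hkK hk1 hdiv hfloor hZblk hkc hc hMrad hM₁ hc' hkc₀ hc₁ h15
    fun ν' M g K k' s hk' hsep hM₁' _ => hEU ν' M g K k' s hk' hsep hM₁'

end Summit.QuantumFields.YangMills.BalabanUVNodes.N12MinimiserFamilyKnitRowOfK0GridGNamedEUOnZOfRecord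

end
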